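import Literature.NumberTheory.EllipticCurves.PeriodIndexTwistedOrbitSums
import Literature.NumberTheory.EllipticCurves.GoodReductionUnramifiedProofs
import Literature.NumberTheory.EllipticCurves.PointDivisibilityProofs
import Literature.NumberTheory.EllipticCurves.GaloisActionProofs
import Literature.NumberTheory.GaloisRepresentations.FrobeniusGeneration
import HarnessLib

/-!
# The index `P²` at a decomposition group (Clark–Sharif 2010, §3.6): instantiating the
# twisted-orbit-sum theorem at `D_𝔓 ≤ Γ_K`

Topic `NumberTheory/EllipticCurves`; theorems only. Sequel of `PeriodIndexTwistedOrbitSums`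
(the abstract theorem `TwistedOrbit.sq_dvd_card_of_twistInvariant`) in the inline proof
programme of `Literature.NumberTheory.EllipticCurves.ClarkSharif2010_thm2` (Clark–Sharif, *Period,
index and potential Ш*, ANT 4 (2010), Theorem 2; the step "`I(C) = P²`" of §3.6).

We discharge the **group-theoretic and elliptic-curve hypotheses** of the abstract theorem for
the decomposition group `D_𝔓 ≤ Γ_K = Gal(K̄/K)` of a prime `𝔓` of `\bar ℤ_K` above a finite place
`v` of good reduction with `v ∤ P`, acting on `E(K̄) = geomPoints W`, with `I = I_𝔓` and `F` an
arithmetic Frobenius `φ` at `𝔓`: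

* `Op` = open subgroups of `D_𝔓` (subspace topology): stable under `⊓`; stabilisers of points are
  open (`WeierstrassCurve.isOpen_stabilizer_point_holds`: `E(K̄)` is a discrete `Γ_K`-module);
  open normal subgroups are cofinal (`D_𝔓` is closed in the profinite `Γ_K`,
  `absIntegers.isClosed_decompositionSubgroup_holds`, hence compact; Mathlib's
  `IsTopologicalGroup.exist_openNormalSubgroup_sub_clopen_nhds_of_one`); open subgroups have
  finite index (compactness);
* density `D_𝔓 = ⋃ₙ φⁿ · I_𝔓 · U` for open `U`
  (`exists_eq_frobenius_pow_mul_of_mem_decompositionSubgroup`, `FrobeniusGeneration`);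
* unramifiedness: `P`-division points of `I_𝔓`-invariants are `I_𝔓`-invariant
  (`WeierstrassCurve.smul_geomPoints_eq_of_mem_inertia`, Silverman VII.4.1 / VIII.1.5);
* `E(K̄)` is `P`-divisible (`WeierstrassCurve.zsmul_geomPoints_surjective_holds`).

What remains hypothesis here (`sq_dvd_card_of_twistInvariant_decompositionSubgroup`): the level
data (`T₁, T₂`, `E[P]` and the junk root fixed by `D_𝔓` — from `E[P*] ⊂ E(K_P)` and the complete
splitting of `v` in `K_P`), the two characters `χ₁, χ₂` of `D_𝔓` with their local shape
(`χ₁|_I` onto, `χ₂` unramified, `χ₂(φ)` a unit — the Kummer characters of Clark–Sharif's pair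
`(a_m, b_m)`, Cor. 17 and Lemma 18), and the **nice-point supply** `hnice`
(`φ^f - 1 : E(K̄)^{I_𝔓} → E[P]` onto for all `f ≥ 1`, to be proved from torsion points and the
reduction map in a sequel).

## References

* P. L. Clark, S. Sharif, *Period, index and potential Ш*, Algebra & Number Theory 4 (2010)
  151–174, §3.6 (`ClarkSharif2010`; arXiv:0811.3019 read).
* J. Neukirch, *Algebraic Number Theory* (1999), Ch. I §9 (decomposition and inertia groups,
  Frobenius) (`NeukirchANT1999`).
* J. H. Silverman, *The Arithmetic of Elliptic Curves*, 2nd ed. (2009), VII.4.1, VIII.§1–2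
  (`SilvermanAEC2009`).
-/

noncomputable section

open scoped Classical Pointwise
open NumberField IsDedekindDomain Field
open Literature.NumberTheory.GaloisRepresentations IsDedekindDomain.HeightOneSpectrum

universe u

namespace Literature.NumberTheory.EllipticCurves

variable {K : Type u} [Field K] [NumberField K] (W : WeierstrassCurve K) [W.IsElliptic]

/-- **Density in a decomposition group, subgroup form.** For an open subgroup `U` of the
decomposition group `D_𝔓` (as a topological group in its own right) and an arithmetic Frobenius
`φ` at `𝔓`, every element of `D_𝔓` is `φⁿ · i · u` with `i ∈ I_𝔓` and `u ∈ U`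
(`exists_eq_frobenius_pow_mul_of_mem_decompositionSubgroup` applied to an open normal subgroup of
`Γ_K` whose trace on `D_𝔓` lies in `U`). [cite: NeukirchANT1999, I §9 Prop. (9.4)] -/
theorem exists_eq_frobenius_pow_mul_of_isOpen {v : HeightOneSpectrum (𝓞 K)}
    {𝔓 : Ideal (absIntegers (𝓞 K) K)} (h𝔓 : 𝔓 ∈ v.primesAbove) {φ : absoluteGaloisGroup K}
    (hφ : IsArithFrobAt (𝓞 K) φ 𝔓)
    (U : Subgroup ↥(𝔓.decompositionSubgroup (absoluteGaloisGroup K)))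
    (hU : IsOpen (U : Set ↥(𝔓.decompositionSubgroup (absoluteGaloisGroup K))))
    (σ : ↥(𝔓.decompositionSubgroup (absoluteGaloisGroup K))) :
    ∃ (n : ℕ) (i u : ↥(𝔓.decompositionSubgroup (absoluteGaloisGroup K))),
      i ∈ 𝔓.inertia ↥(𝔓.decompositionSubgroup (absoluteGaloisGroup K)) ∧ u ∈ U ∧
        σ = (⟨φ, by haveI : 𝔓.IsPrime := h𝔓.1; exact hφ.mem_stabilizer⟩ :
          ↥(𝔓.decompositionSubgroup (absoluteGaloisGroup K))) ^ n * i * u := by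
  haveI : 𝔓.IsPrime := h𝔓.1
  have hφD : φ ∈ 𝔓.decompositionSubgroup (absoluteGaloisGroup K) := hφ.mem_stabilizer
  -- an open normal subgroup `N` of `Γ_K` with `N ∩ D_𝔓 ⊆ U`
  obtain ⟨t, ht, htU⟩ := isOpen_induced_iff.mp hU
  have h1t : (1 : absoluteGaloisGroup K) ∈ t := by
    have : (1 : ↥(𝔓.decompositionSubgroup (absoluteGaloisGroup K))) ∈ Subtype.val ⁻¹' t := by
      rw [htU]
      exact U.one_mem
    exact this
  obtain ⟨N, hN⟩ := ProfiniteGrp.exist_openNormalSubgroup_sub_open_nhds_of_one ht h1t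
  obtain ⟨n, i, u, hi, hu, heq⟩ :=
    exists_eq_frobenius_pow_mul_of_mem_decompositionSubgroup h𝔓 hφ (U := N.toSubgroup)
      N.isOpen' σ.2
  have hiD : i ∈ 𝔓.decompositionSubgroup (absoluteGaloisGroup K) :=
    Ideal.inertia_le_decompositionSubgroup _ _ hi
  have huD : u ∈ 𝔓.decompositionSubgroup (absoluteGaloisGroup K) := by
    have e : u = (φ ^ n * i)⁻¹ * (σ : absoluteGaloisGroup K) := by
      rw [heq, inv_mul_cancel_left]
    rw [e]
    exact Subgroup.mul_mem _ (Subgroup.inv_mem _ (Subgroup.mul_mem _ (Subgroup.pow_mem _ hφD n) hiD)) σ.2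
  refine ⟨n, ⟨i, hiD⟩, ⟨u, huD⟩, Ideal.coe_mem_inertia.mp hi, ?_, Subtype.ext ?_⟩
  · have : (⟨u, huD⟩ : ↥(𝔓.decompositionSubgroup (absoluteGaloisGroup K))) ∈ Subtype.val ⁻¹' t :=
      hN hu
    rwa [htU] at this
  · simpa only [Subgroup.coe_mul, Subgroup.coe_pow] using heq

/-- **Open normal subgroups are cofinal among the open subgroups of a decomposition group**
(`D_𝔓` is closed in the profinite group `Γ_K`, hence a compact topological group; an open
subgroup is clopen; Mathlib's `IsTopologicalGroup.exist_openNormalSubgroup_sub_clopen_nhds_of_one`).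
[folklore] -/
theorem exists_openNormalSubgroup_le {𝔓 : Ideal (absIntegers (𝓞 K) K)}
    (U : Subgroup ↥(𝔓.decompositionSubgroup (absoluteGaloisGroup K)))
    (hU : IsOpen (U : Set ↥(𝔓.decompositionSubgroup (absoluteGaloisGroup K)))) :
    ∃ N : Subgroup ↥(𝔓.decompositionSubgroup (absoluteGaloisGroup K)), N ≤ U ∧ N.Normal ∧
      IsOpen (N : Set ↥(𝔓.decompositionSubgroup (absoluteGaloisGroup K))) := by
  haveI : CompactSpace ↥(𝔓.decompositionSubgroup (absoluteGaloisGroup K)) :=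
    isCompact_iff_compactSpace.mp
      (absIntegers.isClosed_decompositionSubgroup_holds (R := 𝓞 K) (K := K) 𝔓).isCompact
  have hclopen : IsClopen (U : Set ↥(𝔓.decompositionSubgroup (absoluteGaloisGroup K))) :=
    ⟨U.isClosed_of_isOpen hU, hU⟩
  obtain ⟨N, hN⟩ := IsTopologicalGroup.exist_openNormalSubgroup_sub_clopen_nhds_of_one hclopen
    U.one_mem
  exact ⟨N.toSubgroup, fun x hx ↦ hN hx, N.isNormal', N.isOpen'⟩

/-- An open subgroup of a decomposition group has finite index (compactness). [folklore] -/
theorem finiteIndex_of_isOpen_decompositionSubgroup {𝔓 : Ideal (absIntegers (𝓞 K) K)}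
    (U : Subgroup ↥(𝔓.decompositionSubgroup (absoluteGaloisGroup K)))
    (hU : IsOpen (U : Set ↥(𝔓.decompositionSubgroup (absoluteGaloisGroup K)))) :
    U.FiniteIndex := by
  haveI : CompactSpace ↥(𝔓.decompositionSubgroup (absoluteGaloisGroup K)) :=
    isCompact_iff_compactSpace.mp
      (absIntegers.isClosed_decompositionSubgroup_holds (R := 𝓞 K) (K := K) 𝔓).isCompact
  haveI : DiscreteTopology (↥(𝔓.decompositionSubgroup (absoluteGaloisGroup K)) ⧸ U) :=
    QuotientGroup.discreteTopology hU
  haveI : Finite (↥(𝔓.decompositionSubgroup (absoluteGaloisGroup K)) ⧸ U) :=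
    finite_of_compact_of_discrete
  exact Subgroup.finiteIndex_of_finite_quotient

omit [NumberField K] [W.IsElliptic] in
/-- The stabiliser in `D_𝔓` of a geometric point is open (it is the trace of the open stabiliser
in `Γ_K`, `WeierstrassCurve.isOpen_stabilizer_point_holds`). [folklore] -/
theorem isOpen_stabilizer_decompositionSubgroup {𝔓 : Ideal (absIntegers (𝓞 K) K)}
    (a : WeierstrassCurve.geomPoints W) :
    IsOpen (MulAction.stabilizer ↥(𝔓.decompositionSubgroup (absoluteGaloisGroup K)) a :
      Set ↥(𝔓.decompositionSubgroup (absoluteGaloisGroup K))) := by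
  have e : (MulAction.stabilizer ↥(𝔓.decompositionSubgroup (absoluteGaloisGroup K)) a :
      Set ↥(𝔓.decompositionSubgroup (absoluteGaloisGroup K))) =
      Subtype.val ⁻¹' (MulAction.stabilizer (absoluteGaloisGroup K) a : Set (absoluteGaloisGroup K)) := by
    ext σ
    simp only [SetLike.mem_coe, MulAction.mem_stabilizer_iff, Set.mem_preimage]
    rfl
  rw [e]
  exact (WeierstrassCurve.isOpen_stabilizer_point_holds W a).preimage continuous_subtype_val

/-- **The index `P²` at a decomposition group** (Clark–Sharif 2010, §3.6, "`I(C) = P²`", in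
the cocycle-level form of `TwistedOrbit.sq_dvd_card_of_twistInvariant`). Let `E/K` be an
elliptic curve over a number field, `v` a finite place of good reduction with `v ∤ P`, `𝔓 ∣ v` a
prime of `\bar ℤ_K` with decomposition group `D = D_𝔓`, inertia group `I_𝔓` and an arithmetic
Frobenius `φ`. Suppose given: `T₁, T₂ ∈ E(K̄)[P]` independent modulo `P`, with all of `E(K̄)[P]`
fixed by `D` and a `D`-fixed `P`-th root of `(P(P-1)/2) T₁` (level-`P*` structure at a place
split in `K(E[P*])`); additive `χ₁, χ₂ : D → ℤ/P` with open kernels, `χ₁` onto on `I_𝔓`, `χ₂`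
zero on `I_𝔓`, `χ₂(φ)` a unit; and solutions in `E(K̄)^{I_𝔓}` of `φ^f z - z = a` for all
`f ≥ 1`, `a ∈ E[P]`. Then every finite multiset `D ⊂ E(K̄)` invariant under
`σ ⋆ R = σ R + χ₁(σ) T₁ + χ₂(σ) T₂` (`σ ∈ D_𝔓`) whose sum is `P · y` with `y` fixed by `D_𝔓`
has `P² ∣ card D`. The hypotheses "open", "finite index", "density", "unramified" and
"divisible" of the abstract theorem are discharged here from the tree.
[cite: ClarkSharif2010, §3.6] -/
theorem sq_dvd_card_of_twistInvariant_decompositionSubgroup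
    {P : ℕ} [NeZero P] {v : HeightOneSpectrum (𝓞 K)} (hv : W.HasGoodReductionAt v)
    (hvP : ((P : ℕ) : 𝓞 K) ∉ v.asIdeal)
    {𝔓 : Ideal (absIntegers (𝓞 K) K)} (h𝔓 : 𝔓 ∈ v.primesAbove)
    {φ : absoluteGaloisGroup K} (hφ : IsArithFrobAt (𝓞 K) φ 𝔓)
    {T₁ T₂ : WeierstrassCurve.geomPoints W} (hT₁ : P • T₁ = 0) (hT₂ : P • T₂ = 0)
    (hindep : ∀ m n : ℤ, m • T₁ + n • T₂ = 0 → (P : ℤ) ∣ m ∧ (P : ℤ) ∣ n)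
    (hfix : ∀ a : WeierstrassCurve.geomPoints W, P • a = 0 →
      ∀ σ ∈ 𝔓.decompositionSubgroup (absoluteGaloisGroup K), σ • a = a)
    (hjunk : ∃ c : WeierstrassCurve.geomPoints W,
      (∀ σ ∈ 𝔓.decompositionSubgroup (absoluteGaloisGroup K), σ • c = c) ∧
        P • c = (P * (P - 1) / 2) • T₁)
    (χ₁ χ₂ : ↥(𝔓.decompositionSubgroup (absoluteGaloisGroup K)) → ZMod P)
    (hχ₁ : ∀ σ τ, χ₁ (σ * τ) = χ₁ σ + χ₁ τ) (hχ₂ : ∀ σ τ, χ₂ (σ * τ) = χ₂ σ + χ₂ τ)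
    (hχ₁c : IsOpen {σ : ↥(𝔓.decompositionSubgroup (absoluteGaloisGroup K)) | χ₁ σ = 0})
    (hχ₂c : IsOpen {σ : ↥(𝔓.decompositionSubgroup (absoluteGaloisGroup K)) | χ₂ σ = 0})
    (hIχ₁ : ∀ c : ZMod P, ∃ σ : ↥(𝔓.decompositionSubgroup (absoluteGaloisGroup K)),
      (σ : absoluteGaloisGroup K) ∈ 𝔓.inertia (absoluteGaloisGroup K) ∧ χ₁ σ = c)
    (hIχ₂ : ∀ σ : ↥(𝔓.decompositionSubgroup (absoluteGaloisGroup K)),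
      (σ : absoluteGaloisGroup K) ∈ 𝔓.inertia (absoluteGaloisGroup K) → χ₂ σ = 0)
    (hF : IsUnit (χ₂ ⟨φ, by haveI : 𝔓.IsPrime := h𝔓.1; exact hφ.mem_stabilizer⟩))
    (hnice : ∀ f : ℕ, 0 < f → ∀ a : WeierstrassCurve.geomPoints W, P • a = 0 →
      ∃ z : WeierstrassCurve.geomPoints W,
        (∀ σ ∈ 𝔓.inertia (absoluteGaloisGroup K), σ • z = z) ∧ φ ^ f • z - z = a)
    (D : Multiset (WeierstrassCurve.geomPoints W))
    (hD : ∀ (σ : ↥(𝔓.decompositionSubgroup (absoluteGaloisGroup K)))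
      (R : WeierstrassCurve.geomPoints W),
      D.count ((σ : absoluteGaloisGroup K) • R + ((χ₁ σ).val • T₁ + (χ₂ σ).val • T₂)) = D.count R)
    (hsum : ∃ y : WeierstrassCurve.geomPoints W,
      (∀ σ ∈ 𝔓.decompositionSubgroup (absoluteGaloisGroup K), σ • y = y) ∧ D.sum = P • y) :
    P ^ 2 ∣ Multiset.card D := by
  haveI : 𝔓.IsPrime := h𝔓.1
  -- kernels of the characters as subgroups
  obtain ⟨K₁, hK₁⟩ := TwistedOrbit.exists_charKer χ₁ hχ₁
  obtain ⟨K₂, hK₂⟩ := TwistedOrbit.exists_charKer χ₂ hχ₂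
  have hK₁c : IsOpen (K₁ : Set ↥(𝔓.decompositionSubgroup (absoluteGaloisGroup K))) := by
    convert hχ₁c using 1
    ext σ
    exact hK₁ σ
  have hK₂c : IsOpen (K₂ : Set ↥(𝔓.decompositionSubgroup (absoluteGaloisGroup K))) := by
    convert hχ₂c using 1
    ext σ
    exact hK₂ σ
  refine TwistedOrbit.sq_dvd_card_of_twistInvariant
    (𝔓.inertia ↥(𝔓.decompositionSubgroup (absoluteGaloisGroup K)))
    (⟨φ, hφ.mem_stabilizer⟩ : ↥(𝔓.decompositionSubgroup (absoluteGaloisGroup K)))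
    (fun U ↦ IsOpen (U : Set ↥(𝔓.decompositionSubgroup (absoluteGaloisGroup K))))
    (fun U V hU hV ↦ ?_) (isOpen_stabilizer_decompositionSubgroup W)
    exists_openNormalSubgroup_le finiteIndex_of_isOpen_decompositionSubgroup
    (exists_eq_frobenius_pow_mul_of_isOpen (K := K) h𝔓 hφ) hT₁ hT₂ hindep
    (fun a ha σ ↦ hfix a ha σ σ.2) χ₁ χ₂ hχ₁ hχ₂ K₁ hK₁ hK₁c K₂ hK₂ hK₂c ?_ ?_ hF ?_ ?_ ?_ ?_
    D (fun σ R ↦ hD σ R) ?_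
  · -- `Op` is stable under `⊓`
    rw [Subgroup.coe_inf]
    exact hU.inter hV
  · -- `χ₁` onto on inertia
    intro c
    obtain ⟨σ, hσ, hc⟩ := hIχ₁ c
    exact ⟨σ, Ideal.coe_mem_inertia.mp hσ, hc⟩
  · -- `χ₂` kills inertia
    intro σ hσ
    exact hIχ₂ σ (Ideal.coe_mem_inertia.mpr hσ)
  · -- unramifiedness: `P`-division points of `I`-invariants are `I`-invariant
    intro a σ hσ hPa
    have hσ' : (σ : absoluteGaloisGroup K) ∈ 𝔓.inertia (absoluteGaloisGroup K) :=
      Ideal.coe_mem_inertia.mpr hσ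
    change (σ : absoluteGaloisGroup K) • a = a
    refine W.smul_geomPoints_eq_of_mem_inertia hv (n := (P : ℤ)) (by exact_mod_cast hvP) h𝔓 hσ' ?_
    rw [natCast_zsmul]
    exact hPa
  · -- divisibility of `E(K̄)`
    intro a
    obtain ⟨b, hb⟩ := WeierstrassCurve.zsmul_geomPoints_surjective_holds W
      (n := (P : ℤ)) (by exact_mod_cast (NeZero.ne P)) a
    exact ⟨b, by rw [← natCast_zsmul]; exact hb⟩
  · -- the junk root
    obtain ⟨c, hc, hcP⟩ := hjunk
    exact ⟨c, fun σ ↦ hc σ σ.2, hcP⟩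
  · -- nice points
    intro f hf a ha
    obtain ⟨z, hzI, hzF⟩ := hnice f hf a ha
    refine ⟨z, fun σ hσ ↦ hzI σ (Ideal.coe_mem_inertia.mpr hσ), ?_⟩
    exact hzF
  · obtain ⟨y, hy, hsum⟩ := hsum
    exact ⟨y, fun σ ↦ hy σ σ.2, hsum⟩

/-- **`P` divides the degree of every rational divisor, at a decomposition group**: the
companion of `sq_dvd_card_of_twistInvariant_decompositionSubgroup` without the `P`-divisibility
of the sum (`TwistedOrbit.dvd_card_of_twistInvariant`): every finite multiset `D ⊂ E(K̄)`
invariant under the twisted action of `D_𝔓` has `P ∣ card D` (the local period is `P`).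
[cite: ClarkSharif2010, §3.2 and §3.6] -/
theorem dvd_card_of_twistInvariant_decompositionSubgroup
    {P : ℕ} [NeZero P] {v : HeightOneSpectrum (𝓞 K)} (hv : W.HasGoodReductionAt v)
    (hvP : ((P : ℕ) : 𝓞 K) ∉ v.asIdeal)
    {𝔓 : Ideal (absIntegers (𝓞 K) K)} (h𝔓 : 𝔓 ∈ v.primesAbove)
    {φ : absoluteGaloisGroup K} (hφ : IsArithFrobAt (𝓞 K) φ 𝔓)
    {T₁ T₂ : WeierstrassCurve.geomPoints W} (hT₁ : P • T₁ = 0) (hT₂ : P • T₂ = 0)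
    (hindep : ∀ m n : ℤ, m • T₁ + n • T₂ = 0 → (P : ℤ) ∣ m ∧ (P : ℤ) ∣ n)
    (hfix : ∀ a : WeierstrassCurve.geomPoints W, P • a = 0 →
      ∀ σ ∈ 𝔓.decompositionSubgroup (absoluteGaloisGroup K), σ • a = a)
    (hjunk : ∃ c : WeierstrassCurve.geomPoints W,
      (∀ σ ∈ 𝔓.decompositionSubgroup (absoluteGaloisGroup K), σ • c = c) ∧
        P • c = (P * (P - 1) / 2) • T₁)
    (χ₁ χ₂ : ↥(𝔓.decompositionSubgroup (absoluteGaloisGroup K)) → ZMod P)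
    (hχ₁ : ∀ σ τ, χ₁ (σ * τ) = χ₁ σ + χ₁ τ) (hχ₂ : ∀ σ τ, χ₂ (σ * τ) = χ₂ σ + χ₂ τ)
    (hχ₁c : IsOpen {σ : ↥(𝔓.decompositionSubgroup (absoluteGaloisGroup K)) | χ₁ σ = 0})
    (hχ₂c : IsOpen {σ : ↥(𝔓.decompositionSubgroup (absoluteGaloisGroup K)) | χ₂ σ = 0})
    (hIχ₁ : ∀ c : ZMod P, ∃ σ : ↥(𝔓.decompositionSubgroup (absoluteGaloisGroup K)),
      (σ : absoluteGaloisGroup K) ∈ 𝔓.inertia (absoluteGaloisGroup K) ∧ χ₁ σ = c)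
    (hIχ₂ : ∀ σ : ↥(𝔓.decompositionSubgroup (absoluteGaloisGroup K)),
      (σ : absoluteGaloisGroup K) ∈ 𝔓.inertia (absoluteGaloisGroup K) → χ₂ σ = 0)
    (hnice : ∀ f : ℕ, 0 < f → ∀ a : WeierstrassCurve.geomPoints W, P • a = 0 →
      ∃ z : WeierstrassCurve.geomPoints W,
        (∀ σ ∈ 𝔓.inertia (absoluteGaloisGroup K), σ • z = z) ∧ φ ^ f • z - z = a)
    (D : Multiset (WeierstrassCurve.geomPoints W))
    (hD : ∀ (σ : ↥(𝔓.decompositionSubgroup (absoluteGaloisGroup K)))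
      (R : WeierstrassCurve.geomPoints W),
      D.count ((σ : absoluteGaloisGroup K) • R + ((χ₁ σ).val • T₁ + (χ₂ σ).val • T₂)) = D.count R) :
    P ∣ Multiset.card D := by
  haveI : 𝔓.IsPrime := h𝔓.1
  obtain ⟨K₁, hK₁⟩ := TwistedOrbit.exists_charKer χ₁ hχ₁
  obtain ⟨K₂, hK₂⟩ := TwistedOrbit.exists_charKer χ₂ hχ₂
  have hK₁c : IsOpen (K₁ : Set ↥(𝔓.decompositionSubgroup (absoluteGaloisGroup K))) := by
    convert hχ₁c using 1
    ext σ
    exact hK₁ σ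
  have hK₂c : IsOpen (K₂ : Set ↥(𝔓.decompositionSubgroup (absoluteGaloisGroup K))) := by
    convert hχ₂c using 1
    ext σ
    exact hK₂ σ
  refine TwistedOrbit.dvd_card_of_twistInvariant
    (𝔓.inertia ↥(𝔓.decompositionSubgroup (absoluteGaloisGroup K)))
    (⟨φ, hφ.mem_stabilizer⟩ : ↥(𝔓.decompositionSubgroup (absoluteGaloisGroup K)))
    (fun U ↦ IsOpen (U : Set ↥(𝔓.decompositionSubgroup (absoluteGaloisGroup K))))
    (fun U V hU hV ↦ ?_) (isOpen_stabilizer_decompositionSubgroup W)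
    exists_openNormalSubgroup_le finiteIndex_of_isOpen_decompositionSubgroup
    (exists_eq_frobenius_pow_mul_of_isOpen (K := K) h𝔓 hφ) hT₁ hT₂ hindep
    (fun a ha σ ↦ hfix a ha σ σ.2) χ₁ χ₂ hχ₁ hχ₂ K₁ hK₁ hK₁c K₂ hK₂ hK₂c ?_ ?_ ?_ ?_ ?_ ?_
    D (fun σ R ↦ hD σ R)
  · rw [Subgroup.coe_inf]
    exact hU.inter hV
  · intro c
    obtain ⟨σ, hσ, hc⟩ := hIχ₁ c
    exact ⟨σ, Ideal.coe_mem_inertia.mp hσ, hc⟩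
  · intro σ hσ
    exact hIχ₂ σ (Ideal.coe_mem_inertia.mpr hσ)
  · intro a σ hσ hPa
    have hσ' : (σ : absoluteGaloisGroup K) ∈ 𝔓.inertia (absoluteGaloisGroup K) :=
      Ideal.coe_mem_inertia.mpr hσ
    change (σ : absoluteGaloisGroup K) • a = a
    refine W.smul_geomPoints_eq_of_mem_inertia hv (n := (P : ℤ)) (by exact_mod_cast hvP) h𝔓 hσ' ?_
    rw [natCast_zsmul]
    exact hPa
  · intro a
    obtain ⟨b, hb⟩ := WeierstrassCurve.zsmul_geomPoints_surjective_holds W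
      (n := (P : ℤ)) (by exact_mod_cast (NeZero.ne P)) a
    exact ⟨b, by rw [← natCast_zsmul]; exact hb⟩
  · obtain ⟨c, hc, hcP⟩ := hjunk
    exact ⟨c, fun σ ↦ hc σ σ.2, hcP⟩
  · intro f hf a ha
    obtain ⟨z, hzI, hzF⟩ := hnice f hf a ha
    exact ⟨z, fun σ hσ ↦ hzI σ (Ideal.coe_mem_inertia.mpr hσ), hzF⟩

end Literature.NumberTheory.EllipticCurves
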